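import Summits.FinalStateConjecture.FinalStateConjecture.Theorems.EIHFluxBalanceInertialRecessionChargeKinematicsRunPrep
import Summits.FinalStateConjecture.FinalStateConjecture.Theorems.EIHFluxBalanceInertialRecessionChargeKinematicsAnchorRules

/-!
# Route EIHFluxBalance — `InertialRecession`, line `old-light-leaves-the-cone`: charge kinematics, XXX (general N: the anchor bound of a RUN)
Helper file for the crux `stmt-FinalStateConjecture-10166`, second line lead, endgame stub
`stub_expandingChargeKinematics` (S4) FOR GENERAL `N`. `run_anchor_bound`: under the bootstrap invariant every active anchor moves by `< α`
(`anchor_increment_via_rules` with classmates as partners and certified externals).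
Mathlib-only real analysis over the stub's verbatim hypotheses ([folklore]); the abstract charge `P` is adversarial.
-/
set_option linter.dupNamespace false

noncomputable section

open Filter Set Metric Real
open scoped Topology

namespace Summit.FinalStateConjecture.FinalStateConjecture.Theorems.ChargeKinematics

open Literature.Geometry.Lorentzian

/-! ## The anchor bound -/

section RunAnchor

open MeasureTheory intervalIntegral

variable {N : ℕ} {M : Fin N → ℝ} {ξ v : Fin N → ℝ → E3} {κ : ℝ} {P : ℝ → E3 → ℝ → Fin 4 → ℝ}

/-- **The anchor bound of a RUN.** Under the bootstrap invariant on `[t₀, τ]` (increments `≤ α`, intra-class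
relative velocities `≤ 2θ`), with uniform rule-window packages, lateness facts from `t₀` on, linear
isolation of the active group `A` from its complement, inter-class gaps `≥ gap` at `t₀`, and the smallness
inequality, every active anchor `a` has moved by `< α` at time `τ`: `anchor_increment_via_rules` with
partners = classmates, externals = (other classes, certified by `certify_rate`) ∪ (complement, linear) ∪
(virtual `c₂s`). [folklore] -/
theorem run_anchor_bound (hM : ∀ i, 0 < M i) (hξ : ∀ i, ContDiff ℝ ((⊤ : ℕ∞) : WithTop ℕ∞) (ξ i))
    {Cw C' ψst Tw c₂ : ℝ} {ζ D ηa : ℝ → ℝ} (hCw : 0 ≤ Cw) (hC' : 0 ≤ C') (hc₂ : 0 < c₂) (hc₂1 : c₂ ≤ 1)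
    (hpk : ∀ (U : Finset (Fin N)) (a : Fin N),
      ∀ (ψ₀ : ℝ), ψst ≤ ψ₀ → ∀ (s₁ s₂ : ℝ) (ψ : ℝ → ℝ), Tw ≤ s₁ → ψ₀ ≤ c₂ * s₁ → s₁ ≤ s₂ →
        (∀ s ∈ Set.Icc s₁ s₂, ∀ s' ∈ Set.Icc s₁ s₂, |ψ s - ψ s'| ≤ 4 * |s - s'|) →
        (∀ s ∈ Set.Icc s₁ s₂, ψ₀ ≤ ψ s ∧ (∀ j ∈ U, 4 * ‖ξ a s - ξ j s‖ ≤ ψ s ∧ 2 * ‖ξ a s - ξ j s‖ ≤ c₂ * s) ∧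
          ∀ l ∉ U, ψ s ≤ ‖ξ l s - ξ a s‖) →
        (∀ μ : Fin 4, |P s₂ (ξ a s₂) (min (ψ s₂ / 2) (c₂ * s₂)) μ -
            P s₁ (ξ a s₁) (min (ψ s₁ / 2) (c₂ * s₁)) μ| ≤
          Cw * (∫ s in s₁..s₂, ((min (ψ s / 2) (c₂ * s)) ^ 2)⁻¹ +
            ((min (ψ s / 2) (c₂ * s)) ^ (7 / 4 : ℝ))⁻¹) + ηa s₁) ∧
        (∀ s ∈ Set.Icc s₁ s₂,
          |P s (ξ a s) (min (ψ s / 2) (c₂ * s)) 0 - ∑ j ∈ U, M j * (√(1 - ‖v j s‖ ^ 2))⁻¹| ≤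
              (1 + U.card) * ζ s + C' * (2 * (1 + 8 * U.card) / ψ₀ + 6 * U.card / D s) ∧
          ∀ k' : Fin 3, |P s (ξ a s) (min (ψ s / 2) (c₂ * s)) k'.succ -
              ∑ j ∈ U, M j * (√(1 - ‖v j s‖ ^ 2))⁻¹ * v j s k'| ≤
              (1 + U.card) * ζ s + C' * (2 * (1 + 8 * U.card) / ψ₀ + 6 * U.card / D s)))
    (A : Finset (Fin N)) (cl : Fin N → ℕ) {a : Fin N} (ha : a ∈ A)
    {k μ gap α θ gmin t₀ τ m₀ ψ₀ ε : ℝ}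
    (hk1 : k < 1) (hμ1 : μ ≤ 1) (hθ : 0 < θ) (hθα : θ ≤ α) (hαgap : 16 * α ≤ gap)
    (hgmin : 0 < gmin) (hgmin_gap : gmin ≤ gap / 2) (hgmin_μ : gmin ≤ μ) (hgmin_c₂ : gmin ≤ c₂)
    (hθrate : 4 * (4 * 16 ^ N) * (2 * θ) ≤ gmin)
    (ht₀ : 0 < t₀) (hτ : t₀ ≤ τ) (hm₀ : 0 < m₀) (hm₀C : 4 * 16 ^ N ≤ m₀) (hm₀ψ : (2 * 16 ^ N) * ψ₀ ≤ m₀)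
    (hψst : ψst ≤ ψ₀) (hψ₀ : 0 < ψ₀) (hTw : Tw ≤ t₀) (hψc : ψ₀ ≤ c₂ * t₀) (hct : 1 ≤ c₂ * t₀)
    (hm₀c : m₀ ≤ c₂ * t₀) (hε : 0 ≤ ε)
    (hkv : ∀ i s, t₀ ≤ s → ‖v i s‖ ≤ k)
    (hσ : ∀ i s, t₀ ≤ s → ‖deriv (ξ i) s - v i s‖ ≤ θ / 2)
    (hlip : ∀ i s s', t₀ ≤ s → t₀ ≤ s' → ‖ξ i s - ξ i s'‖ ≤ 2 * |s - s'|)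
    (hfloor : ∀ i j, i ≠ j → ∀ s, t₀ ≤ s → m₀ ≤ ‖ξ i s - ξ j s‖)
    (hXlin : ∀ x ∉ A, ∀ i ∈ A, ∀ s, t₀ ≤ s → μ * s ≤ ‖ξ x s - ξ i s‖)
    (hewε : ∀ s, t₀ ≤ s → ηa s + ((1 + N) * ζ s + C' * (2 * (1 + 8 * N) / ψ₀ + 6 * N / D s)) ≤ ε)
    (hζD : ∀ s, t₀ ≤ s → 0 ≤ ζ s ∧ 1 ≤ D s) (hηa : ∀ s, 0 ≤ ηa s)
    (hsmall : (1 + 4 * (N : ℝ) * (N + 1) * (N + 1)) *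
      (4 * (Cw * ((N + 1) * ((9 * (2 * 2 * (3 * m₀ / (4 * 16 ^ N)) ^ (1 - 2 : ℝ) /
        ((2 - 1) * (3 * gmin / (4 * 16 ^ N)))) +
        (3 : ℝ) ^ (7 / 4 : ℝ) * (2 * (7 / 4) * (3 * m₀ / (4 * 16 ^ N)) ^ (1 - 7 / 4 : ℝ) /
          ((7 / 4 - 1) * (3 * gmin / (4 * 16 ^ N))))) +
        ((c₂ ^ 2 * t₀)⁻¹ + 4 / 3 * c₂ ^ (-(7 / 4) : ℝ) * t₀ ^ (-(3 / 4) : ℝ)))) + 3 * ε) / M a +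
        2 * (2 * θ)) < α)
    (hinter : ∀ i ∈ A, ∀ j ∈ A, cl i ≠ cl j → gap ≤ ‖v i t₀ - v j t₀‖)
    (hINVα : ∀ s ∈ Set.Icc t₀ τ, ∀ i ∈ A, ‖v i s - v i t₀‖ ≤ α)
    (hINVθ : ∀ s ∈ Set.Icc t₀ τ, ∀ i ∈ A, ∀ j ∈ A, cl i = cl j → ‖v i s - v j s‖ ≤ 2 * θ) :
    ‖v a τ - v a t₀‖ < α := by
  classical
  have hd : ∀ i, Differentiable ℝ (ξ i) := fun i ↦ (contDiff_infty_iff_deriv.mp (hξ i)).1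
  have hdc : ∀ i, Continuous (deriv (ξ i)) := fun i ↦ (contDiff_infty_iff_deriv.mp (hξ i)).2.continuous
  have h16N : (1 : ℝ) ≤ 16 ^ N := one_le_pow₀ (by norm_num)
  -- the partners: classmates of `a`
  obtain ⟨T, hTdef⟩ : ∃ T : Finset (Fin N), T = (A.filter fun p ↦ cl p = cl a).erase a := ⟨_, rfl⟩
  have haT : a ∉ T := by rw [hTdef]; exact Finset.notMem_erase a _
  have hTmem : ∀ p ∈ T, p ∈ A ∧ cl p = cl a ∧ p ≠ a := fun p hp ↦ by
    rw [hTdef] at hp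
    obtain ⟨hpa, hp'⟩ := Finset.mem_erase.mp hp
    exact ⟨(Finset.mem_filter.mp hp').1, (Finset.mem_filter.mp hp').2, hpa⟩
  have hTcard : T.card ≤ N := (Finset.card_le_univ T).trans (by simp)
  -- the real externals: everything outside `insert a T`
  obtain ⟨Yr, hYrdef⟩ : ∃ Yr : Finset (Fin N),
      Yr = Finset.univ.filter fun y ↦ y ≠ a ∧ (y ∉ A ∨ cl y ≠ cl a) := ⟨_, rfl⟩
  have hYr_of : ∀ l, l ≠ a → l ∉ T → l ∈ Yr := by
    intro l hla hlT
    rw [hYrdef]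
    refine Finset.mem_filter.mpr ⟨Finset.mem_univ _, hla, ?_⟩
    by_contra hcon
    push Not at hcon
    rw [hTdef] at hlT
    exact hlT (Finset.mem_erase.mpr ⟨hla, Finset.mem_filter.mpr ⟨hcon.1, hcon.2⟩⟩)
  have hYrmem : ∀ y ∈ Yr, y ≠ a ∧ (y ∉ A ∨ cl y ≠ cl a) := fun y hy ↦ by
    rw [hYrdef] at hy
    exact (Finset.mem_filter.mp hy).2
  -- unit vectors of the initial inter-class relative velocities
  obtain ⟨u, hu⟩ : ∃ f : Fin N → E3, ∀ y, f y = ‖v y t₀ - v a t₀‖⁻¹ • (v y t₀ - v a t₀) := ⟨_, fun y ↦ rfl⟩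
  have hufacts : ∀ y ∈ A, cl y ≠ cl a →
      ‖u y‖ = 1 ∧ @inner ℝ E3 _ (u y) (v y t₀ - v a t₀) = ‖v y t₀ - v a t₀‖ := by
    intro y hy hcl
    have hne : v y t₀ - v a t₀ ≠ 0 := by
      intro h0
      have := hinter y hy a ha hcl
      rw [h0, norm_zero] at this
      linarith
    rw [hu y]
    exact unit_smul_facts hne
  -- the certified coordinates, indexed by `Fin N ⊕ Unit`
  obtain ⟨φ, hφA, hφX, hφV⟩ : ∃ f : (Fin N ⊕ Unit) → ℝ → ℝ,
      (∀ y ∈ A, ∀ s, f (Sum.inl y) s = @inner ℝ E3 _ (u y) (ξ y s - ξ a s)) ∧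
      (∀ y ∉ A, ∀ s, f (Sum.inl y) s = μ * s) ∧ (∀ z : Unit, ∀ s, f (Sum.inr z) s = c₂ * s) := by
    refine ⟨Sum.elim (fun y s ↦ if y ∈ A then @inner ℝ E3 _ (u y) (ξ y s - ξ a s) else μ * s)
      (fun _ s ↦ c₂ * s), fun y hy s ↦ ?_, fun y hy s ↦ ?_, fun z s ↦ ?_⟩
    · simp [hy]
    · simp [hy]
    · simp
  obtain ⟨φ', hφ'A, hφ'X, hφ'V⟩ : ∃ f : (Fin N ⊕ Unit) → ℝ → ℝ,
      (∀ y ∈ A, ∀ s, f (Sum.inl y) s = @inner ℝ E3 _ (u y) (deriv (ξ y) s - deriv (ξ a) s)) ∧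
      (∀ y ∉ A, ∀ s, f (Sum.inl y) s = μ) ∧ (∀ z : Unit, ∀ s, f (Sum.inr z) s = c₂) := by
    refine ⟨Sum.elim (fun y s ↦ if y ∈ A then @inner ℝ E3 _ (u y) (deriv (ξ y) s - deriv (ξ a) s) else μ)
      (fun _ _ ↦ c₂), fun y hy s ↦ ?_, fun y hy s ↦ ?_, fun z s ↦ ?_⟩
    · simp [hy]
    · simp [hy]
    · simp
  obtain ⟨Y, hYdef⟩ : ∃ Y : Finset (Fin N ⊕ Unit),
      Y = insert (Sum.inr ()) (Yr.map ⟨Sum.inl, Sum.inl_injective⟩) := ⟨_, rfl⟩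
  have hinrY : Sum.inr () ∈ Y := by rw [hYdef]; exact Finset.mem_insert_self _ _
  have hY : Y.Nonempty := ⟨Sum.inr (), hinrY⟩
  have hYmem : ∀ z ∈ Y, z = Sum.inr () ∨ ∃ y ∈ Yr, z = Sum.inl y := by
    intro z hz
    rw [hYdef] at hz
    rcases Finset.mem_insert.mp hz with h | h
    · exact Or.inl h
    · right
      obtain ⟨y, hy, rfl⟩ := Finset.mem_map.mp h
      exact ⟨y, hy, rfl⟩
  have hinlY : ∀ y ∈ Yr, (Sum.inl y : Fin N ⊕ Unit) ∈ Y := fun y hy ↦ by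
    rw [hYdef]; exact Finset.mem_insert_of_mem (Finset.mem_map.mpr ⟨y, hy, rfl⟩)
  have hYcard : (Y.card : ℝ) ≤ N + 1 := by
    have h1 : Y.card ≤ (Yr.map (⟨Sum.inl, Sum.inl_injective⟩ : Fin N ↪ Fin N ⊕ Unit)).card + 1 := by
      rw [hYdef]; exact Finset.card_insert_le _ _
    rw [Finset.card_map] at h1
    have h2 : Yr.card ≤ N := (Finset.card_le_univ Yr).trans (by simp)
    have : (Y.card : ℝ) ≤ Yr.card + 1 := by exact_mod_cast h1
    have : (Yr.card : ℝ) ≤ N := by exact_mod_cast h2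
    linarith
  -- derivative, continuity and Lipschitz facts of the coordinates
  have hYru : ∀ y ∈ Yr, y ∈ A → ‖u y‖ = 1 := by
    intro y hy hyA
    rcases (hYrmem y hy).2 with h | h
    · exact (h hyA).elim
    · exact (hufacts y hyA h).1
  obtain ⟨hφderiv, hφ'cont, hφlip⟩ := coordinate_facts hd hdc a u (hgmin.trans_le hgmin_μ) hμ1 hc₂ hc₂1
    hlip hφA hφX hφV hφ'A hφ'X hφ'V Y Yr hYmem hYru
  have hclear : ∀ y ∈ Yr, ∀ s, t₀ ≤ s → max m₀ |φ (Sum.inl y) s| ≤ ‖ξ y s - ξ a s‖ := by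
    intro y hy s hs
    have hya : y ≠ a := (hYrmem y hy).1
    refine max_le (hfloor y a hya s hs) ?_
    by_cases hyA : y ∈ A
    · rw [hφA y hyA]
      have hcl : cl y ≠ cl a := by
        rcases (hYrmem y hy).2 with h | h
        · exact (h hyA).elim
        · exact h
      exact abs_inner_le_norm_of_unit (hufacts y hyA hcl).1
    · rw [hφX y hyA, abs_of_pos (mul_pos (hgmin.trans_le hgmin_μ) (ht₀.trans_le hs))]
      exact hXlin y hyA a ha s hs
  -- the clearance function `c`
  obtain ⟨c, hc⟩ : ∃ f : ℝ → ℝ, ∀ s, f s = Y.inf' hY fun z ↦ max m₀ |φ z s| := ⟨_, fun s ↦ rfl⟩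
  have hcm₀ : ∀ s, m₀ ≤ c s := fun s ↦ by
    rw [hc s]; exact (Finset.le_inf'_iff hY _).mpr fun z _ ↦ le_max_left _ _
  have hcc₂ : ∀ s, t₀ ≤ s → c s ≤ c₂ * s := by
    intro s hs
    rw [hc s]
    refine (Finset.inf'_le _ hinrY).trans ?_
    rw [hφV, abs_of_pos (mul_pos hc₂ (ht₀.trans_le hs))]
    exact max_le (hm₀c.trans (by nlinarith)) le_rfl
  have hclip : ∀ s, t₀ ≤ s → ∀ s', t₀ ≤ s' → |c s - c s'| ≤ 4 * |s - s'| := by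
    intro s hs s' hs'
    rw [hc s, hc s']
    exact abs_inf'_sub_inf'_le hY fun z hz ↦
      (abs_max_abs_sub_le m₀ _ _).trans (hφlip z hz s hs s' hs')
  have hcle : ∀ y ∈ Yr, ∀ s, t₀ ≤ s → c s ≤ ‖ξ y s - ξ a s‖ := fun y hy s hs ↦ by
    rw [hc s]
    exact (Finset.inf'_le _ (hinlY y hy)).trans (hclear y hy s hs)
  -- the certified rates on `[t₀, τ]`
  have hmono : ∀ z ∈ Y, ∀ s ∈ Set.Icc t₀ τ, gmin ≤ φ' z s := by
    intro z hz s hs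
    rcases hYmem z hz with rfl | ⟨y, hy, rfl⟩
    · rw [hφ'V]; exact hgmin_c₂
    · by_cases hyA : y ∈ A
      · have hcl : cl y ≠ cl a := by
          rcases (hYrmem y hy).2 with h | h
          · exact (h hyA).elim
          · exact h
        rw [hφ'A y hyA]
        obtain ⟨hu1, hur⟩ := hufacts y hyA hcl
        have key := certify_rate (db := deriv (ξ y) s) (dx := deriv (ξ a) s) hu1 hur (hinter y hyA a ha hcl)
          (hINVα s hs y hyA) (hINVα s hs a ha) (hσ y s hs.1) (hσ a s hs.1)
        linarith
      · rw [hφ'X y hyA]; exact hgmin_μ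
  -- apply the anchor lemma
  have hanc := anchor_increment_via_rules T a Y hY (n := N) hTcard
    (d := fun p s ↦ ‖ξ a s - ξ p s‖) (φ := φ) (φ' := φ') (g := fun _ ↦ gmin) (Mc := M) (v := v)
    (Qw := fun j Ms s μ' ↦ P s (ξ a s) (min ((Y.inf' hY fun z ↦ max m₀ |φ z s|) / (4 * 16 ^ (j : ℕ))) (c₂ * s)) μ')
    (ew := fun _ ↦ ε) (Cw := Cw) (k := k) (t₁ := t₀) (t₂ := τ) (m₀ := m₀) (c₂ := c₂) (ε := ε) (β' := 2 * θ)
    (θ := 2 * θ) hk1 ht₀ hτ hm₀ hm₀C hc₂ hct hCw hε (by linarith)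
    (fun i _ ↦ hM i) haT
    (fun i _ s hs ↦ hkv i s hs.1)
    (fun p hp s hs ↦ hINVθ s hs p (hTmem p hp).1 a ha (hTmem p hp).2.1) (by linarith)
    (fun p _ ↦ ((hd a).continuous.sub (hd p).continuous).norm)
    ?_ ?_ ?_ (fun _ _ ↦ hgmin) (fun _ _ ↦ hθrate) hφderiv hφ'cont hmono ?_ (fun _ _ ↦ le_rfl)
  rotate_left
  · -- slow distances: rate ≤ 3θ ≤ 4θ
    intro p hp s hs s' hs' hss'
    have hC : ∀ x ∈ Set.Icc t₀ τ, ‖deriv (ξ a) x - deriv (ξ p) x‖ ≤ 2 * (2 * θ) := by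
      intro x hx
      have h1 := hσ a x hx.1
      have h2 := hσ p x hx.1
      have h3 := hINVθ x hx p (hTmem p hp).1 a ha (hTmem p hp).2.1
      calc ‖deriv (ξ a) x - deriv (ξ p) x‖
          = ‖(deriv (ξ a) x - v a x) - (deriv (ξ p) x - v p x) - (v p x - v a x)‖ := by congr 1; abel
        _ ≤ ‖deriv (ξ a) x - v a x‖ + ‖deriv (ξ p) x - v p x‖ + ‖v p x - v a x‖ := by
            exact (norm_sub_le _ _).trans (add_le_add (norm_sub_le _ _) le_rfl)
        _ ≤ 2 * (2 * θ) := by linarith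
    have := norm_sub_sub_le_of_deriv (hd a) (hd p) hC hs hs' hss'
    exact (abs_norm_sub_norm_le _ _).trans this
  · -- floor
    intro p hp s hs
    exact hfloor a p (hTmem p hp).2.2.symm s hs.1
  · -- clearance cap
    intro s hs
    rw [← hc s]; exact hcc₂ s hs.1
  · -- the packages
    intro j Ms hMs s₁ s₂ h1 h12 h2 hgeom
    have hs₁0 : t₀ ≤ s₁ := h1
    have hCj : (0 : ℝ) < 4 * 16 ^ (j : ℕ) := by positivity
    have h16j : (16 : ℝ) ^ (j : ℕ) ≤ 16 ^ N := pow_le_pow_right₀ (by norm_num) (Nat.lt_succ_iff.mp j.2)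
    -- the clearance function of this rule
    obtain ⟨ψ, hψ⟩ : ∃ f : ℝ → ℝ, ∀ s, f s = 2 * (c s / (4 * 16 ^ (j : ℕ))) := ⟨_, fun s ↦ rfl⟩
    have hψhalf : ∀ s, ψ s / 2 = c s / (4 * 16 ^ (j : ℕ)) := fun s ↦ by rw [hψ s]; ring
    have hψlec : ∀ s, ψ s ≤ c s := fun s ↦ by
      rw [hψ s]
      have : c s / (4 * 16 ^ (j : ℕ)) ≤ c s / 4 :=
        div_le_div_of_nonneg_left (hm₀.le.trans (hcm₀ s)) (by norm_num)
          (by have : (1:ℝ) ≤ 16 ^ (j : ℕ) := one_le_pow₀ (by norm_num); linarith)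
      linarith only [this, hcm₀ s, hm₀]
    have hψ₀le : ∀ s, ψ₀ ≤ ψ s := fun s ↦ by
      rw [hψ s]
      have h1' : m₀ / (4 * 16 ^ N) ≤ c s / (4 * 16 ^ (j : ℕ)) := by
        calc m₀ / (4 * 16 ^ N) ≤ m₀ / (4 * 16 ^ (j : ℕ)) :=
              div_le_div_of_nonneg_left hm₀.le hCj (by linarith)
          _ ≤ c s / (4 * 16 ^ (j : ℕ)) := div_le_div_of_nonneg_right (hcm₀ s) hCj.le
      have h2' : ψ₀ ≤ 2 * (m₀ / (4 * 16 ^ N)) := by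
        rw [mul_div_assoc', le_div_iff₀ (by positivity)]
        have : ψ₀ * (4 * 16 ^ N) = 2 * ((2 * 16 ^ N) * ψ₀) := by ring
        rw [this]; linarith only [hm₀ψ]
      linarith only [h1', h2']
    have hU := hpk (insert a Ms) a ψ₀ hψst s₁ s₂ ψ (hTw.trans hs₁0)
      (hψc.trans (mul_le_mul_of_nonneg_left hs₁0 hc₂.le)) h12 ?_ ?_
    rotate_left
    · intro s hs s' hs'
      rw [hψ s, hψ s']
      have := hclip s (hs₁0.trans hs.1) s' (hs₁0.trans hs'.1)
      have hdiv : |2 * (c s / (4 * 16 ^ (j : ℕ))) - 2 * (c s' / (4 * 16 ^ (j : ℕ)))| =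
          |c s - c s'| * (2 / (4 * 16 ^ (j : ℕ))) := by
        rw [← mul_sub, ← sub_div, abs_mul, abs_div, abs_of_pos hCj, abs_of_pos (by norm_num : (0:ℝ) < 2)]
        ring
      rw [hdiv]
      have h2C : (2 : ℝ) / (4 * 16 ^ (j : ℕ)) ≤ 1 := by
        rw [div_le_one hCj]
        have : (1:ℝ) ≤ 16 ^ (j : ℕ) := one_le_pow₀ (by norm_num); linarith
      calc |c s - c s'| * (2 / (4 * 16 ^ (j : ℕ))) ≤ |c s - c s'| * 1 :=
            mul_le_mul_of_nonneg_left h2C (abs_nonneg _)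
        _ ≤ 4 * |s - s'| := by rw [mul_one]; exact this
    · intro s hs
      have hs0 : t₀ ≤ s := hs₁0.trans hs.1
      obtain ⟨hgm, hgn⟩ := hgeom s hs
      refine ⟨hψ₀le s, fun j' hj' ↦ ?_, fun l hl ↦ ?_⟩
      · rcases Finset.mem_insert.mp hj' with rfl | hj'M
        · simp only [sub_self, norm_zero, mul_zero]
          exact ⟨by linarith [hψ₀le s], mul_nonneg hc₂.le (ht₀.le.trans hs0)⟩
        · obtain ⟨h4, h2'⟩ := hgm j' hj'M
          refine ⟨?_, h2'⟩
          rw [hψ s, hc s]; exact h4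
      · have hla : l ≠ a := fun h ↦ hl (h ▸ Finset.mem_insert_self a Ms)
        by_cases hlT : l ∈ T
        · have := hgn l hlT (fun h ↦ hl (Finset.mem_insert_of_mem h))
          rw [hψ s, hc s, norm_sub_rev]; exact this
        · exact (hψlec s).trans (hcle l (hYr_of l hla hlT) s hs0)
    obtain ⟨hlaw, hid⟩ := hU
    -- error bounds by `ε`
    have hUcard : ((insert a Ms).card : ℝ) ≤ N := by
      have := Finset.card_le_univ (insert a Ms)
      simp only [Fintype.card_fin] at this
      exact_mod_cast this
    have herrle : ∀ s, t₀ ≤ s → (1 + ((insert a Ms).card : ℝ)) * ζ s +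
        C' * (2 * (1 + 8 * ((insert a Ms).card : ℝ)) / ψ₀ + 6 * ((insert a Ms).card : ℝ) / D s) ≤ ε := by
      intro s hs
      obtain ⟨hζ0, hD1⟩ := hζD s hs
      have hDpos : 0 < D s := one_pos.trans_le hD1
      have h1' : (1 + ((insert a Ms).card : ℝ)) * ζ s ≤ (1 + N) * ζ s :=
        mul_le_mul_of_nonneg_right (by linarith) hζ0
      have h2' : 2 * (1 + 8 * ((insert a Ms).card : ℝ)) / ψ₀ ≤ 2 * (1 + 8 * N) / ψ₀ :=
        div_le_div_of_nonneg_right (by linarith) hψ₀.le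
      have h3' : 6 * ((insert a Ms).card : ℝ) / D s ≤ 6 * N / D s :=
        div_le_div_of_nonneg_right (by linarith) hDpos.le
      have h4' := mul_le_mul_of_nonneg_left (add_le_add h2' h3') hC'
      have h5' := hewε s hs
      linarith [hηa s]
    have hηε : ηa s₁ ≤ ε := by
      have h5' := hewε s₁ hs₁0
      obtain ⟨hζ0, hD1⟩ := hζD s₁ hs₁0
      have hDpos : 0 < D s₁ := one_pos.trans_le hD1
      have : 0 ≤ (1 + (N : ℝ)) * ζ s₁ + C' * (2 * (1 + 8 * N) / ψ₀ + 6 * N / D s₁) := by positivity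
      linarith
    refine ⟨fun μ' ↦ ?_, fun s hs' ↦ ?_⟩
    · have := hlaw μ'
      simp only [hψhalf, hc] at this
      linarith
    · have hsI : s ∈ Set.Icc s₁ s₂ := by
        rcases hs' with rfl | rfl
        · exact ⟨le_rfl, h12⟩
        · exact ⟨h12, le_rfl⟩
      obtain ⟨h0, hk'⟩ := hid s hsI
      have hb := herrle s (hs₁0.trans hsI.1)
      simp only [hψhalf, hc] at h0 hk'
      exact ⟨h0.trans hb, fun k' ↦ (hk' k').trans hb⟩
  -- final arithmetic: the anchor lemma's bound is at most the smallness quantity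
  clear hpk hφderiv hφ'cont hφlip hclear hmono hINVα hINVθ hinter hewε hkv hσ hlip hfloor hXlin
  refine lt_of_le_of_lt (hanc.trans ?_) hsmall
  have hMa : 0 < M a := hM a
  -- abbreviate the fly-by constant
  obtain ⟨F, hF⟩ : ∃ x : ℝ, x = 9 * (2 * 2 * (3 * m₀ / (4 * 16 ^ N)) ^ (1 - 2 : ℝ) /
      ((2 - 1) * (3 * gmin / (4 * 16 ^ N)))) +
      (3 : ℝ) ^ (7 / 4 : ℝ) * (2 * (7 / 4) * (3 * m₀ / (4 * 16 ^ N)) ^ (1 - 7 / 4 : ℝ) /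
        ((7 / 4 - 1) * (3 * gmin / (4 * 16 ^ N)))) := ⟨_, rfl⟩
  obtain ⟨tl, htl⟩ : ∃ x : ℝ, x = (c₂ ^ 2 * t₀)⁻¹ + 4 / 3 * c₂ ^ (-(7 / 4) : ℝ) * t₀ ^ (-(3 / 4) : ℝ) := ⟨_, rfl⟩
  have hFnn : 0 ≤ F := by rw [hF]; positivity
  have htlnn : 0 ≤ tl := by rw [htl]; positivity
  rw [← hF, ← htl]
  have hsum : ∑ _z ∈ Y, (F + tl) = Y.card * (F + tl) := by rw [Finset.sum_const, nsmul_eq_mul]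
  rw [hsum]
  -- monotonicity in `|T| ≤ N`, `|Y| ≤ N + 1`
  have hT' : (T.card : ℝ) ≤ N := by exact_mod_cast hTcard
  have hN : (0 : ℝ) ≤ N := Nat.cast_nonneg N
  have hYc : (0 : ℝ) ≤ Y.card := Nat.cast_nonneg _
  have hpieces : (1 + 4 * (T.card : ℝ) * (N + 1) * Y.card) ≤ 1 + 4 * (N : ℝ) * (N + 1) * (N + 1) := by
    have h1 : (T.card : ℝ) * Y.card ≤ N * (N + 1) :=
      mul_le_mul hT' hYcard hYc hN
    have h2 : (1 + 4 * (T.card : ℝ) * (N + 1) * Y.card) = 1 + 4 * (N + 1) * ((T.card : ℝ) * Y.card) := by ring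
    have h3 : (1 + 4 * (N : ℝ) * (N + 1) * (N + 1)) = 1 + 4 * (N + 1) * ((N : ℝ) * (N + 1)) := by ring
    rw [h2, h3]
    have h4 : (0 : ℝ) ≤ 4 * (N + 1) := by positivity
    have := mul_le_mul_of_nonneg_left h1 h4
    linarith only [this]
  have hinner : 4 * (Cw * (Y.card * (F + tl)) + 3 * ε) / M a + 2 * (2 * θ) ≤
      4 * (Cw * ((N + 1) * (F + tl)) + 3 * ε) / M a + 2 * (2 * θ) := by
    have h1 : Y.card * (F + tl) ≤ (N + 1) * (F + tl) :=
      mul_le_mul_of_nonneg_right hYcard (by linarith only [hFnn, htlnn])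
    have h2 := mul_le_mul_of_nonneg_left h1 hCw
    have h3 : 4 * (Cw * (Y.card * (F + tl)) + 3 * ε) ≤ 4 * (Cw * ((N + 1) * (F + tl)) + 3 * ε) := by
      linarith only [h2]
    have := div_le_div_of_nonneg_right h3 hMa.le
    linarith only [this]
  have hinner_nn : 0 ≤ 4 * (Cw * (Y.card * (F + tl)) + 3 * ε) / M a + 2 * (2 * θ) := by positivity
  calc (1 + 4 * (T.card : ℝ) * (N + 1) * Y.card) * (4 * (Cw * (Y.card * (F + tl)) + 3 * ε) / M a + 2 * (2 * θ))
      ≤ (1 + 4 * (N : ℝ) * (N + 1) * (N + 1)) * (4 * (Cw * (Y.card * (F + tl)) + 3 * ε) / M a + 2 * (2 * θ)) :=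
        mul_le_mul_of_nonneg_right hpieces hinner_nn
    _ ≤ (1 + 4 * (N : ℝ) * (N + 1) * (N + 1)) * (4 * (Cw * ((N + 1) * (F + tl)) + 3 * ε) / M a + 2 * (2 * θ)) :=
        mul_le_mul_of_nonneg_left hinner (by positivity)

end RunAnchor

end Summit.FinalStateConjecture.FinalStateConjecture.Theorems.ChargeKinematics

namespace Summit.FinalStateConjecture.FinalStateConjecture.Theorems

/-- REGISTERED STUB `run_anchor_bound` of the crux item stmt-FinalStateConjecture-10166 (second line lead, line
`old-light-leaves-the-cone`, S4): the registered signature verbatim, by `ChargeKinematics.run_anchor_bound`. [folklore] -/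
theorem run_anchor_bound : open Literature.Geometry.Lorentzian Filter Topology MeasureTheory intervalIntegral in ∀ {N : ℕ} {M : Fin N → ℝ} {ξ v : Fin N → ℝ → E3} {P : ℝ → E3 → ℝ → Fin 4 → ℝ} (hM : ∀ i, 0 < M i) (hξ : ∀ i, ContDiff ℝ ((⊤ : ℕ∞) : WithTop ℕ∞) (ξ i)) {Cw C' ψst Tw c₂ : ℝ} {ζ D ηa : ℝ → ℝ} (hCw : 0 ≤ Cw) (hC' : 0 ≤ C') (hc₂ : 0 < c₂) (hc₂1 : c₂ ≤ 1) (hpk : ∀ (U : Finset (Fin N)) (a : Fin N), ∀ (ψ₀ : ℝ), ψst ≤ ψ₀ → ∀ (s₁ s₂ : ℝ) (ψ : ℝ → ℝ), Tw ≤ s₁ → ψ₀ ≤ c₂ * s₁ → s₁ ≤ s₂ → (∀ s ∈ Set.Icc s₁ s₂, ∀ s' ∈ Set.Icc s₁ s₂, |ψ s - ψ s'| ≤ 4 * |s - s'|) → (∀ s ∈ Set.Icc s₁ s₂, ψ₀ ≤ ψ s ∧ (∀ j ∈ U, 4 * ‖ξ a s - ξ j s‖ ≤ ψ s ∧ 2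 * ‖ξ a s - ξ j s‖ ≤ c₂ * s) ∧ ∀ l ∉ U, ψ s ≤ ‖ξ l s - ξ a s‖) → (∀ μ : Fin 4, |P s₂ (ξ a s₂) (min (ψ s₂ / 2) (c₂ * s₂)) μ - P s₁ (ξ a s₁) (min (ψ s₁ / 2) (c₂ * s₁)) μ| ≤ Cw * (∫ s in s₁..s₂, ((min (ψ s / 2) (c₂ * s)) ^ 2)⁻¹ + ((min (ψ s / 2) (c₂ * s)) ^ (7 / 4 : ℝ))⁻¹) + ηa s₁) ∧ (∀ s ∈ Set.Icc s₁ s₂, |P s (ξ a s) (min (ψ s / 2) (c₂ * s)) 0 - ∑ j ∈ U, M j * (√(1 - ‖v j s‖ ^ 2))⁻¹| ≤ (1 + U.card) * ζ s + C' * (2 * (1 + 8 * U.card) / ψ₀ + 6 * U.card / D s) ∧ ∀ k' : Fin 3, |P s (ξ a s) (min (ψ s / 2) (c₂ * s)) k'.succ - ∑ j ∈ U, M j * (√(1 - ‖v j s‖ ^ 2))⁻¹ * v j s k'| ≤ (1 + U.card) * ζ s + C' * (2 * (1 + 8 * U.card) / ψ₀ + 6 * U.card / D s))) (A : Finset (Fin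 N)) (cl : Fin N → ℕ) {a : Fin N} (ha : a ∈ A) {k μ gap α θ gmin t₀ τ m₀ ψ₀ ε : ℝ} (hk1 : k < 1) (hμ1 : μ ≤ 1) (hθ : 0 < θ) (hθα : θ ≤ α) (hαgap : 16 * α ≤ gap) (hgmin : 0 < gmin) (hgmin_gap : gmin ≤ gap / 2) (hgmin_μ : gmin ≤ μ) (hgmin_c₂ : gmin ≤ c₂) (hθrate : 4 * (4 * 16 ^ N) * (2 * θ) ≤ gmin) (ht₀ : 0 < t₀) (hτ : t₀ ≤ τ) (hm₀ : 0 < m₀) (hm₀C : 4 * 16 ^ N ≤ m₀) (hm₀ψ : (2 * 16 ^ N) * ψ₀ ≤ m₀) (hψst : ψst ≤ ψ₀) (hψ₀ : 0 < ψ₀) (hTw : Tw ≤ t₀) (hψc : ψ₀ ≤ c₂ * t₀) (hct : 1 ≤ c₂ * t₀) (hm₀c : m₀ ≤ c₂ * t₀) (hε : 0 ≤ ε) (hkv : ∀ i s, t₀ ≤ s → ‖v i s‖ ≤ k) (hσ : ∀ i s, t₀ ≤ s → ‖deriv (ξ i) s - v i s‖ ≤ θ / 2) (hlip : ∀ i s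 s', t₀ ≤ s → t₀ ≤ s' → ‖ξ i s - ξ i s'‖ ≤ 2 * |s - s'|) (hfloor : ∀ i j, i ≠ j → ∀ s, t₀ ≤ s → m₀ ≤ ‖ξ i s - ξ j s‖) (hXlin : ∀ x ∉ A, ∀ i ∈ A, ∀ s, t₀ ≤ s → μ * s ≤ ‖ξ x s - ξ i s‖) (hewε : ∀ s, t₀ ≤ s → ηa s + ((1 + N) * ζ s + C' * (2 * (1 + 8 * N) / ψ₀ + 6 * N / D s)) ≤ ε) (hζD : ∀ s, t₀ ≤ s → 0 ≤ ζ s ∧ 1 ≤ D s) (hηa : ∀ s, 0 ≤ ηa s) (hsmall : (1 + 4 * (N : ℝ) * (N + 1) * (N + 1)) * (4 * (Cw * ((N + 1) * ((9 * (2 * 2 * (3 * m₀ / (4 * 16 ^ N)) ^ (1 - 2 : ℝ) / ((2 - 1) * (3 * gmin / (4 * 16 ^ N)))) + (3 : ℝ) ^ (7 / 4 : ℝ) * (2 * (7 / 4) * (3 * m₀ / (4 * 16 ^ N)) ^ (1 - 7 / 4 : ℝ) / ((7 / 4 - 1) * (3 * gmin / (4 * 16 ^ N))))) + ((c₂ ^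 2 * t₀)⁻¹ + 4 / 3 * c₂ ^ (-(7 / 4) : ℝ) * t₀ ^ (-(3 / 4) : ℝ)))) + 3 * ε) / M a + 2 * (2 * θ)) < α) (hinter : ∀ i ∈ A, ∀ j ∈ A, cl i ≠ cl j → gap ≤ ‖v i t₀ - v j t₀‖) (hINVα : ∀ s ∈ Set.Icc t₀ τ, ∀ i ∈ A, ‖v i s - v i t₀‖ ≤ α) (hINVθ : ∀ s ∈ Set.Icc t₀ τ, ∀ i ∈ A, ∀ j ∈ A, cl i = cl j → ‖v i s - v j s‖ ≤ 2 * θ), ‖v a τ - v a t₀‖ < α :=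
  @ChargeKinematics.run_anchor_bound

end Summit.FinalStateConjecture.FinalStateConjecture.Theorems

end
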